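import Literature.MathematicalPhysics.QuantumLattice.HeisenbergOrderNeelGD
import Literature.MathematicalPhysics.QuantumLattice.HeisenbergOrderTranslationProofs
import Literature.MathematicalPhysics.QuantumLattice.AndersonHeisenbergStarBound
import HarnessLib

/-!
# Kennedy–Lieb–Shastry 1988, eqs. (10)–(11) and Table I: Néel order from short-range correlations

Topic `MathematicalPhysics/QuantumLattice`; sibling of `HeisenbergOrder.lean` (named facts
`dyson_lieb_simon`, `kennedy_lieb_shastry_ground`) and of the proof files
`HeisenbergOrderNeelProofs.lean`, `HeisenbergOrderNeelAssembly.lean`, `HeisenbergOrderNeelGD.lean`.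
No named fact is introduced; every declaration below is a definition with a body or a proved
theorem.

Kennedy, Lieb and Shastry, *Existence of Néel order in some spin-½ Heisenberg antiferromagnets*,
J. Stat. Phys. **53** (1988) 1019–1030 (`KLS1988JSP`), prove ground-state Néel order for `d = 3`
and for `d = 2, S ≥ 1` (tree: `kennedy_lieb_shastry_ground_holds`) and write, for the open case
`d = 2, S = ½` (p. 1023): "Although we cannot prove the existence of Néel order for spin 1/2 in two
dimensions, we will show how to obtain sufficient conditions for the existence of Néel order which
only involve the two-point function at relatively short distances. Define
`ḡ(n) = (n+1)⁻¹ Σ_{m=0}^{n} (-1)^m ⟨S³_0 S³_{m δᵢ}⟩` (10) … If there is no Néel order, then the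
infrared bound implies
`ḡ(n) = ∫dq (2(n+1))⁻¹ Σ_{m=0}^{n} (-1)^m [cos(m q₁) + cos(m q₂)] g_q ≤ ∫dq {…}₊ f_q` (11)",
with `f_q = (e₀ E_q / 6d E_{q-Q})^{1/2}` their infrared bound (1), and (p. 1030) "Rigorous lower
bounds on the short-range correlations could prove the existence of Néel order (see Table I)".

This file proves the FINITE-VOLUME form of (11) on the even tori `(ℤ/2kℤ)^d` — where "no Néel
order" is not assumed and the `δ`-function at `Q` becomes the term `|Λ|⁻¹ ĝ_Q`, i.e. the Néel order
parameter itself — and packages it as a criterion: eventual lower bounds on the short-range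
staggered sums `ḡ_L(N)`, an eventual lower bound on the ground-state energy per site (which
controls `f_q`) and an eventual upper bound on the punctured Riemann sums of the kernel `{K_N}₊ f`
imply `HasStaggeredEvenTorusLRO` for the ground states (all spins `n/2`, all `d ≥ 1`, all `J > 0`).
The `T = 0` infrared bound (1) is the tree's unconditional theorem `heis_infraredBound`
(`HeisenbergOrderNeelGD.lean`); nothing numerical is asserted here (KLS's Table I values are inputs a
user must certify, exactly like `klsRiemannSum_three_eventually_le` for the `d = 3` theorem).

* `heisStagShortRangeSum N L n` — `ḡ_L(N)`: the site- and direction-averaged staggered short-range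
  sum `(3 d (N+1) L^d)⁻¹ Σ_x Σ_i Σ_{m ≤ N} (-1)^m ⟨𝐒_x · 𝐒_{x + m eᵢ}⟩_{GS,L}` (KLS (10) uses one
  component `S³` and the translation-invariant infinite-volume state; the factor `3` and the site
  average give the same number by isotropy and translation invariance);
* `klsShortRangeKernel N L q` — `K_N(q) = (d(N+1))⁻¹ Σ_i Σ_{m ≤ N} (-1)^m cos(m qᵢ)` (KLS (11),
  `d = 2`), with `K_N(Q) = 1`;
* `klsShortRangeRiemannSum N L` — `𝓡_L(N) = L^{-d} Σ_{q ≠ Q} {K_N(q)}₊ (E_q/E_{q-Q})^{1/2}`, the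
  punctured Riemann sum of the integrand of (11) divided by `(-ε/2)^{1/2}`
  (`f_q = (-ε/2)^{1/2} (E_q/E_{q-Q})^{1/2}` in the tree's normalisation `e₀ = -3dε`,
  `ε = heisBondCorr`); after the shift `p = q - Q` the summand is
  `{(d(N+1))⁻¹ Σ_i Σ_m cos(m pᵢ)}₊ [Σᵢ(1 + cos pᵢ)/Σᵢ(1 - cos pᵢ)]^{1/2}`;
* `heisStagShortRangeSum_eq_sum_kernel` — the Parseval identity `ḡ_L(N) = |Λ|⁻¹ Σ_q K_N(q) ĝ_q`;
* `kls_heis_ineq11` — **(11) in finite volume**: `ḡ_L(N) ≤ |Λ|⁻¹ ĝ_Q + (-ε/2)^{1/2} 𝓡_L(N)`;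
* `neg_heisBondCorr_div_two_le` — `-ε/2 ≤ e/(6d)` from `E₀/L^d ≥ -e`;
* `heis_neelOrder_of_shortRangeCorr` — the criterion, and its `d = 2`, `S = ½` instance
  `neelOrder_spinHalf_square_of_shortRangeCorr` (the shape a certified short-range bracket for the
  square lattice would instantiate; Table I's thresholds are `(e₀/12)^{1/2} ∫{K_N}₊(E_q/E_{q-Q})^{1/2}`).

## References

* [KLS1988JSP] T. Kennedy, E. H. Lieb, B. S. Shastry, J. Stat. Phys. 53 (1988) 1019–1030,
  eqs. (1), (3), (10), (11), Table I, p. 1030 (read in: E. H. Lieb, *Statistical Mechanics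
  (Selecta)*, Springer 2004, paper IV.7).
* [DysonLiebSimon1978] F. J. Dyson, E. H. Lieb, B. Simon, J. Stat. Phys. 18 (1978) 335–383, §1.

## Design

The momentum identity is the character orthogonality of `(ℤ/Lℤ)^d` at a general displacement `z`
(`sum_structureFactor_mul_cos_torusPhase`, generalising the tree's nearest-neighbour
`sum_structureFactor_mul_cos`), combined with `cos(m qᵢ) = cos(q · m eᵢ)` on the discrete torus
(`cos_natCast_mul_latticeMomentum`). Everything else follows `HeisenbergOrderNeelAssembly.lean`
(`kls_heis_ineq4`, `heis_neelOrder_of_infraredBound`) with the kernel `d⁻¹ Σᵢ cos qᵢ` replaced by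
`K_N`. Hypotheses of the criterion are stated along the sides `2k + 2` of
`hasStaggeredEvenTorusLRO_iff`, so that a torus-wise certificate "for all `L ≥ L₀`" instantiates
them directly.
-/

noncomputable section

open Filter Topology Matrix Finset
open Literature.MathematicalPhysics.QuantumLattice Literature.Probability.LatticeModels

namespace Literature.MathematicalPhysics.QuantumLattice

variable {d : ℕ}

/-! ### The objects of KLS (10)–(11) in finite volume -/

/-- **KLS's short-range staggered sum `ḡ_L(N)`** on the torus of side `L` (spin `n/2`, `J = 1`):
`(3 d (N+1) L^d)⁻¹ Σ_x Σ_i Σ_{m=0}^{N} (-1)^m ⟨𝐒_x · 𝐒_{x + m eᵢ}⟩_{GS,L}`, i.e. the average over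
sites `x`, directions `i` and components of `(N+1)⁻¹ Σ_{m ≤ N} (-1)^m ⟨S³_x S³_{x+mδᵢ}⟩`
(junk value `0` at `L = 0`). [Kennedy–Lieb–Shastry 1988, eq. (10)] [cite: KLS1988JSP, eq. (10)] -/
def heisStagShortRangeSum (N L n : ℕ) : ℝ :=
  if hL : L = 0 then 0
  else
    haveI : NeZero L := ⟨hL⟩
    (∑ x : TorusSite d L, ∑ i : Fin d, ∑ m ∈ range (N + 1),
        (-1 : ℝ) ^ m * groundStateSpinCorrTorus L n 1 x (x + Pi.single i ((m : ℕ) : ZMod L))) /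
      (3 * (d : ℝ) * ((N : ℝ) + 1) * (L : ℝ) ^ d)

/-- **KLS's kernel** `K_N(q) = (d(N+1))⁻¹ Σ_i Σ_{m=0}^{N} (-1)^m cos(m qᵢ)` at the dual-torus point
`q` (`qᵢ = latticeMomentum L q i`); for `d = 2` this is the bracket in (11),
`(2(n+1))⁻¹ Σ_m (-1)^m [cos(m q₁) + cos(m q₂)]`. [Kennedy–Lieb–Shastry 1988, eq. (11)]
[cite: KLS1988JSP, eq. (11)] -/
def klsShortRangeKernel (N L : ℕ) (q : TorusSite d L) : ℝ :=
  (∑ i : Fin d, ∑ m ∈ range (N + 1), (-1 : ℝ) ^ m * Real.cos ((m : ℝ) * latticeMomentum L q i)) /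
    ((d : ℝ) * ((N : ℝ) + 1))

/-- **The punctured Riemann sum of the integrand of (11)**,
`𝓡_L(N) = L^{-d} Σ_{q ≠ Q} {K_N(q)}₊ (E_q/E_{q-Q})^{1/2}` (`E_q = Σᵢ(1 - cos qᵢ)`, `Q = (π,…,π)`);
KLS's bound (11) is `(-ε/2)^{1/2}` times its `L → ∞` limit `∫ dq {K_N(q)}₊ (E_q/E_{q-Q})^{1/2}`
(junk value `0` at `L = 0`). [Kennedy–Lieb–Shastry 1988, eq. (11) and Table I]
[cite: KLS1988JSP, eq. (11)] -/
def klsShortRangeRiemannSum (N L : ℕ) : ℝ :=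
  if hL : L = 0 then 0
  else
    haveI : NeZero L := ⟨hL⟩
    (∑ q ∈ (univ : Finset (TorusSite d L)).erase (neelIndex L),
        max (klsShortRangeKernel N L q) 0 *
          Real.sqrt (dispersion (latticeMomentum L q) /
            dispersion (latticeMomentum L (q - neelIndex L)))) / (L : ℝ) ^ d

/-! ### Unfolding lemmas -/

/-- Unfolding `ḡ_L(N)` on a genuine torus. [folklore] -/
theorem heisStagShortRangeSum_of_neZero (N L : ℕ) [NeZero L] (n : ℕ) :
    heisStagShortRangeSum (d := d) N L n =
      (∑ x : TorusSite d L, ∑ i : Fin d, ∑ m ∈ range (N + 1),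
          (-1 : ℝ) ^ m * groundStateSpinCorrTorus L n 1 x (x + Pi.single i ((m : ℕ) : ZMod L))) /
        (3 * (d : ℝ) * ((N : ℝ) + 1) * (L : ℝ) ^ d) := by
  simp [heisStagShortRangeSum, NeZero.ne L]

/-- Unfolding `𝓡_L(N)` on a genuine torus. [folklore] -/
theorem klsShortRangeRiemannSum_of_neZero (N L : ℕ) [NeZero L] :
    klsShortRangeRiemannSum (d := d) N L =
      (∑ q ∈ (univ : Finset (TorusSite d L)).erase (neelIndex L),
          max (klsShortRangeKernel N L q) 0 *
            Real.sqrt (dispersion (latticeMomentum L q) /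
              dispersion (latticeMomentum L (q - neelIndex L)))) / (L : ℝ) ^ d := by
  simp [klsShortRangeRiemannSum, NeZero.ne L]

/-- `𝓡_L(N) ≥ 0`. [folklore] -/
theorem klsShortRangeRiemannSum_nonneg (N L : ℕ) : 0 ≤ klsShortRangeRiemannSum (d := d) N L := by
  rcases Nat.eq_zero_or_pos L with rfl | hL
  · simp [klsShortRangeRiemannSum]
  haveI : NeZero L := ⟨hL.ne'⟩
  rw [klsShortRangeRiemannSum_of_neZero]
  refine div_nonneg (sum_nonneg fun q _ => mul_nonneg (le_max_right _ _) (Real.sqrt_nonneg _)) ?_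
  positivity

/-! ### Characters: `cos(m qᵢ) = cos(q · m eᵢ)` and orthogonality at a general displacement -/

/-- On the discrete torus, `cos(m pᵢ) = cos(p · (m eᵢ))` with the displacement `m eᵢ` read in
`(ℤ/Lℤ)^d` (the two phases differ by `2π (kᵢ ⌊m/L⌋) ∈ 2πℤ`). [folklore] -/
theorem cos_natCast_mul_latticeMomentum (L : ℕ) [NeZero L] (q : TorusSite d L) (i : Fin d)
    (m : ℕ) :
    Real.cos ((m : ℝ) * latticeMomentum L q i) =
      Real.cos (torusPhase L q (Pi.single i ((m : ℕ) : ZMod L))) := by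
  have hL : (L : ℝ) ≠ 0 := by exact_mod_cast NeZero.ne L
  have hph : torusPhase L q (Pi.single i ((m : ℕ) : ZMod L)) =
      2 * Real.pi * (((q i).val : ℝ) * ((m % L : ℕ) : ℝ)) / L := by
    unfold torusPhase
    congr 2
    rw [Fintype.sum_eq_single i]
    · rw [Pi.single_eq_same, ZMod.val_natCast]
    · intro j hj
      rw [Pi.single_eq_of_ne hj, ZMod.val_zero, Nat.cast_zero, mul_zero]
  rw [hph, latticeMomentum_apply]
  have hm : (m : ℝ) = ((m % L : ℕ) : ℝ) + (L : ℝ) * ((m / L : ℕ) : ℝ) := by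
    exact_mod_cast (Nat.mod_add_div m L).symm
  rw [hm]
  have h : (((m % L : ℕ) : ℝ) + (L : ℝ) * ((m / L : ℕ) : ℝ)) *
        (2 * Real.pi * (((q i).val : ℕ) : ℝ) / L) =
      2 * Real.pi * ((((q i).val : ℕ) : ℝ) * ((m % L : ℕ) : ℝ)) / L +
        ((((q i).val * (m / L) : ℕ)) : ℝ) * (2 * Real.pi) := by
    push_cast
    field_simp
  rw [h, Real.cos_add_nat_mul_two_pi]

/-- Product-to-sum on the discrete torus: `cos(p·w) cos(p·z) = ½ (cos(p·(w + z)) + cos(p·(w - z)))`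
(through the characters of `(ℤ/Lℤ)^d`). [folklore] -/
theorem cos_torusPhase_mul_cos_torusPhase (L : ℕ) [NeZero L] (q w z : TorusSite d L) :
    Real.cos (torusPhase L q w) * Real.cos (torusPhase L q z) =
      (Real.cos (torusPhase L q (w + z)) + Real.cos (torusPhase L q (w - z))) / 2 := by
  rw [← torusChar_re L q w, ← torusChar_re L q z, ← torusChar_re L q (w + z),
    ← torusChar_re L q (w - z), torusChar_add, sub_eq_add_neg, torusChar_add, torusChar_neg]
  simp only [Complex.mul_re, Complex.star_def, Complex.conj_re, Complex.conj_im]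
  ring

/-- **Character orthogonality at a general displacement**: for a symmetric kernel `G` on the
torus of side `L` and any `z ∈ (ℤ/Lℤ)^d`,
`Σ_q (Σ_{x,y} cos(p_q·(x-y)) G(x,y)) cos(p_q·z) = L^d Σ_x G(x, x + z)`
(the tree's `sum_structureFactor_mul_cos` is the case `z = eᵢ`). [Kennedy–Lieb–Shastry 1988,
eqs. (3), (10)–(11)] [folklore] -/
theorem sum_structureFactor_mul_cos_torusPhase (L : ℕ) [NeZero L]
    (G : TorusSite d L → TorusSite d L → ℝ) (hG : ∀ x y, G x y = G y x) (z : TorusSite d L) :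
    ∑ q : TorusSite d L, (∑ x : TorusSite d L, ∑ y : TorusSite d L,
        Real.cos (torusPhase L q (x - y)) * G x y) * Real.cos (torusPhase L q z) =
      (L : ℝ) ^ d * ∑ x : TorusSite d L, G x (x + z) := by
  -- expand, exchange the momentum sum with the site sums, and use orthogonality
  have h1 : ∀ x y : TorusSite d L,
      ∑ q : TorusSite d L, Real.cos (torusPhase L q (x - y)) * G x y *
        Real.cos (torusPhase L q z) =
      G x y * (((if x - y + z = 0 then ((L : ℝ) ^ d) else 0) +
        (if x - y - z = 0 then ((L : ℝ) ^ d) else 0)) / 2) := by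
    intro x y
    have : ∀ q : TorusSite d L, Real.cos (torusPhase L q (x - y)) * G x y *
        Real.cos (torusPhase L q z) =
        G x y * ((Real.cos (torusPhase L q (x - y + z)) +
          Real.cos (torusPhase L q (x - y - z))) / 2) := by
      intro q
      rw [mul_right_comm, cos_torusPhase_mul_cos_torusPhase, mul_comm]
    simp_rw [this]
    rw [← mul_sum, ← sum_div, sum_add_distrib, sum_cos_torusPhase, sum_cos_torusPhase]
  have hswap : ∑ q : TorusSite d L, (∑ x : TorusSite d L, ∑ y : TorusSite d L,
      Real.cos (torusPhase L q (x - y)) * G x y) * Real.cos (torusPhase L q z) =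
      ∑ x : TorusSite d L, ∑ y : TorusSite d L, ∑ q : TorusSite d L,
        Real.cos (torusPhase L q (x - y)) * G x y * Real.cos (torusPhase L q z) := by
    simp_rw [sum_mul]
    rw [sum_comm]
    exact sum_congr rfl fun x _ => sum_comm
  rw [hswap]
  simp_rw [h1]
  -- the two Kronecker deltas
  have h2 : ∀ x : TorusSite d L, ∑ y : TorusSite d L,
      G x y * (((if x - y + z = 0 then ((L : ℝ) ^ d) else 0) +
        (if x - y - z = 0 then ((L : ℝ) ^ d) else 0)) / 2) =
      (L : ℝ) ^ d / 2 * (G x (x + z) + G x (x - z)) := by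
    intro x
    have hα : ∀ y : TorusSite d L, (x - y + z = 0) ↔ (y = x + z) := fun y => by
      constructor <;> intro h
      · rw [← sub_eq_zero]; rw [← neg_eq_zero, ← h]; abel
      · rw [h]; abel
    have hβ : ∀ y : TorusSite d L, (x - y - z = 0) ↔ (y = x - z) := fun y => by
      constructor <;> intro h
      · rw [← sub_eq_zero]; rw [← neg_eq_zero, ← h]; abel
      · rw [h]; abel
    have hA : ∀ y : TorusSite d L, (if x - y + z = 0 then ((L : ℝ) ^ d) else 0) =
        if y = x + z then ((L : ℝ) ^ d) else 0 := fun y => if_congr (hα y) rfl rfl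
    have hB : ∀ y : TorusSite d L, (if x - y - z = 0 then ((L : ℝ) ^ d) else 0) =
        if y = x - z then ((L : ℝ) ^ d) else 0 := fun y => if_congr (hβ y) rfl rfl
    simp_rw [hA, hB]
    have hterm : ∀ y : TorusSite d L, G x y * (((if y = x + z then ((L : ℝ) ^ d) else 0) +
        (if y = x - z then ((L : ℝ) ^ d) else 0)) / 2) =
        (if y = x + z then (L : ℝ) ^ d / 2 * G x y else 0) +
          (if y = x - z then (L : ℝ) ^ d / 2 * G x y else 0) := by
      intro y
      split_ifs <;> ring
    simp_rw [hterm]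
    rw [sum_add_distrib, sum_ite_eq' univ (x + z), sum_ite_eq' univ (x - z)]
    simp only [mem_univ, if_true]
    ring
  simp_rw [h2]
  rw [← mul_sum, sum_add_distrib]
  -- reindex the second sum and use the symmetry of `G`
  have h3 : ∑ x : TorusSite d L, G x (x - z) = ∑ x : TorusSite d L, G x (x + z) := by
    rw [← Equiv.sum_comp (Equiv.addRight z) (fun x => G x (x - z))]
    refine sum_congr rfl fun x _ => ?_
    simp only [Equiv.coe_addRight, add_sub_cancel_right]
    exact hG _ _
  rw [h3]
  ring

/-- The structure factor against `cos(m qᵢ)`: `Σ_q ĝ_q cos(m qᵢ) = Σ_x G(x, x + m eᵢ)`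
(`ĝ = heisStructureFactor 0`, `G = heisGroundCorr 0`). [Kennedy–Lieb–Shastry 1988, eq. (11),
first equality] [cite: KLS1988JSP, eq. (11)] -/
theorem sum_heisStructureFactor_mul_cos (L : ℕ) [NeZero L] (n : ℕ) (i : Fin d) (m : ℕ) :
    ∑ q : TorusSite d L, heisStructureFactor 0 L n q * Real.cos ((m : ℝ) * latticeMomentum L q i) =
      ∑ x : TorusSite d L, heisGroundCorr 0 L n x (x + Pi.single i ((m : ℕ) : ZMod L)) := by
  have hL : (L : ℝ) ^ d ≠ 0 := by
    have : (L : ℝ) ≠ 0 := by exact_mod_cast NeZero.ne L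
    positivity
  simp_rw [heisStructureFactor_of_neZero, cos_natCast_mul_latticeMomentum L _ i m, div_mul_eq_mul_div]
  rw [← sum_div, sum_structureFactor_mul_cos_torusPhase L (heisGroundCorr 0 L n)
    (heisGroundCorr_symm 0 L n) (Pi.single i ((m : ℕ) : ZMod L)), mul_div_cancel_left₀ _ hL]

/-! ### The Parseval identity `ḡ_L(N) = |Λ|⁻¹ Σ_q K_N(q) ĝ_q` -/

/-- `⟨𝐒_x · 𝐒_y⟩_{GS} = 3 G⁰(x,y)` at `J = 1` (isotropy (I)). [Kennedy–Lieb–Shastry 1988, p. 1021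
("the expectation of `S³_xS³_y` is one-third of the expectation of `𝐒_x·𝐒_y`")] [folklore] -/
theorem groundStateSpinCorrTorus_one_eq_three_mul (L n : ℕ) (x y : TorusSite d L) :
    groundStateSpinCorrTorus L n 1 x y = 3 * heisGroundCorr 0 L n x y := by
  rw [groundStateSpinCorrTorus_eq_sum L n one_pos, Fin.sum_univ_three,
    heisGroundCorr_eq_zero_comp 1, heisGroundCorr_eq_zero_comp 2]
  ring

/-- **Parseval form of (10)–(11)**: `ḡ_L(N) = |Λ|⁻¹ Σ_q K_N(q) ĝ_q`.
[Kennedy–Lieb–Shastry 1988, eq. (11), first equality] [cite: KLS1988JSP, eqs. (10)–(11)] -/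
theorem heisStagShortRangeSum_eq_sum_kernel (L : ℕ) [NeZero L] (hd : 1 ≤ d) (n N : ℕ) :
    heisStagShortRangeSum (d := d) N L n =
      (∑ q : TorusSite d L, klsShortRangeKernel N L q * heisStructureFactor 0 L n q) /
        (L : ℝ) ^ d := by
  have hd0 : (d : ℝ) ≠ 0 := by exact_mod_cast (show d ≠ 0 by omega)
  have hN : ((N : ℝ) + 1) ≠ 0 := by positivity
  have hL : (L : ℝ) ^ d ≠ 0 := by
    have : (L : ℝ) ≠ 0 := by exact_mod_cast NeZero.ne L
    positivity
  -- the common core `S = Σ_i Σ_m (-1)^m Σ_x G⁰(x, x + m eᵢ)`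
  set S : ℝ := ∑ i : Fin d, ∑ m ∈ range (N + 1), (-1 : ℝ) ^ m *
    ∑ x : TorusSite d L, heisGroundCorr 0 L n x (x + Pi.single i ((m : ℕ) : ZMod L)) with hS
  -- left-hand side
  have hlhs : (∑ x : TorusSite d L, ∑ i : Fin d, ∑ m ∈ range (N + 1),
      (-1 : ℝ) ^ m * groundStateSpinCorrTorus L n 1 x (x + Pi.single i ((m : ℕ) : ZMod L))) =
      3 * S := by
    rw [sum_comm, hS, mul_sum]
    refine sum_congr rfl fun i _ => ?_
    rw [sum_comm, mul_sum]
    refine sum_congr rfl fun m _ => ?_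
    simp only [mul_sum]
    refine sum_congr rfl fun x _ => ?_
    rw [groundStateSpinCorrTorus_one_eq_three_mul]
    ring
  -- right-hand side
  have hrhs : (∑ q : TorusSite d L, klsShortRangeKernel N L q * heisStructureFactor 0 L n q) =
      S / ((d : ℝ) * ((N : ℝ) + 1)) := by
    have hq : ∀ q : TorusSite d L, klsShortRangeKernel N L q * heisStructureFactor 0 L n q =
        (∑ i : Fin d, ∑ m ∈ range (N + 1), (-1 : ℝ) ^ m *
          (heisStructureFactor 0 L n q * Real.cos ((m : ℝ) * latticeMomentum L q i))) /
          ((d : ℝ) * ((N : ℝ) + 1)) := by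
      intro q
      rw [klsShortRangeKernel, div_mul_eq_mul_div, sum_mul]
      congr 1
      refine sum_congr rfl fun i _ => ?_
      rw [sum_mul]
      refine sum_congr rfl fun m _ => ?_
      ring
    simp_rw [hq]
    rw [← sum_div, sum_comm]
    congr 1
    rw [hS]
    refine sum_congr rfl fun i _ => ?_
    rw [sum_comm]
    refine sum_congr rfl fun m _ => ?_
    rw [← mul_sum, sum_heisStructureFactor_mul_cos L n i m]
  rw [heisStagShortRangeSum_of_neZero, hlhs, hrhs]
  field_simp

/-! ### The kernel at the Néel point -/

section NeelPoint

variable (k : ℕ) [NeZero (2 * k)]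

/-- `K_N(Q) = 1` (`cos(mπ) = (-1)^m`). [Kennedy–Lieb–Shastry 1988, eq. (11) (the `δ`-function at
`Q` enters with weight one)] [folklore] -/
theorem klsShortRangeKernel_neelIndex (hd : 1 ≤ d) (N : ℕ) :
    klsShortRangeKernel N (2 * k) (neelIndex (2 * k) : TorusSite d (2 * k)) = 1 := by
  have hd0 : (d : ℝ) ≠ 0 := by exact_mod_cast (show d ≠ 0 by omega)
  have hN : ((N : ℝ) + 1) ≠ 0 := by positivity
  unfold klsShortRangeKernel
  simp_rw [latticeMomentum_neelIndex k, Real.cos_nat_mul_pi, ← mul_pow, neg_mul_neg, one_mul, one_pow,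
    sum_const, card_range, card_univ, Fintype.card_fin, nsmul_eq_mul, mul_one]
  push_cast
  field_simp

end NeelPoint

/-! ### (11) in finite volume -/

/-- The pointwise step of (11): from the infrared bound `0 ≤ g`, `g² E' ≤ s E` (`E' > 0`, `s ≥ 0`)
one gets `K g ≤ s^{1/2} {K}₊ (E/E')^{1/2}`. [Kennedy–Lieb–Shastry 1988, from (1) to (11)]
[folklore] -/
theorem kls_heis_pointwise11 {g E' E K s : ℝ} (hg : 0 ≤ g) (hE' : 0 < E') (hs : 0 ≤ s)
    (hA : g ^ 2 * E' ≤ s * E) :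
    K * g ≤ Real.sqrt s * (max K 0 * Real.sqrt (E / E')) := by
  have h3 : g ^ 2 ≤ s * (E / E') := by
    rw [mul_div_assoc', le_div_iff₀ hE']
    exact hA
  have h4 : g ≤ Real.sqrt s * Real.sqrt (E / E') := by
    rw [← Real.sqrt_mul hs]
    exact Real.le_sqrt_of_sq_le h3
  calc K * g ≤ max K 0 * g := mul_le_mul_of_nonneg_right (le_max_left _ _) hg
    _ ≤ max K 0 * (Real.sqrt s * Real.sqrt (E / E')) :=
        mul_le_mul_of_nonneg_left h4 (le_max_right _ _)
    _ = Real.sqrt s * (max K 0 * Real.sqrt (E / E')) := by ring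

/-- **Kennedy–Lieb–Shastry's inequality (11) in finite volume.** On the even torus of side
`L = 2k ≥ 4`, `d ≥ 1`, every spin `n/2`:
`ḡ_L(N) ≤ |Λ|⁻¹ ĝ_Q + (-ε/2)^{1/2} 𝓡_L(N)`, `ε = heisBondCorr` the nearest-neighbour correlation per
component (`-ε/2 ≥ S²/6 > 0` by the Néel bound): write `ḡ_L(N) = |Λ|⁻¹ Σ_q K_N(q) ĝ_q`, split off
`q = Q` (`K_N(Q) = 1`) and bound every other term by the unconditional `T = 0` infrared bound
`heis_infraredBound` (`ĝ_q ≤ (-ε/2)^{1/2}(E_q/E_{q-Q})^{1/2}`, KLS (1)) and `K ≤ {K}₊`. In the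
infinite volume and WITHOUT the `|Λ|⁻¹ĝ_Q` term ("if there is no Néel order") this is (11).
[Kennedy–Lieb–Shastry 1988, eq. (11)] [cite: KLS1988JSP, eq. (11)] -/
theorem kls_heis_ineq11 (hd : 1 ≤ d) (n N k : ℕ) (hk : 2 ≤ k) :
    heisStagShortRangeSum (d := d) N (2 * k) n ≤
      heisStructureFactor 0 (2 * k) n (neelIndex (2 * k) : TorusSite d (2 * k)) /
          ((2 * k : ℕ) : ℝ) ^ d +
        Real.sqrt (-heisBondCorr (d := d) 0 (2 * k) n / 2) *
          klsShortRangeRiemannSum (d := d) N (2 * k) := by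
  haveI : NeZero (2 * k) := ⟨by omega⟩
  have hd0 : 0 < d := by omega
  have h2k : (0 : ℝ) < ((2 * k : ℕ) : ℝ) := by exact_mod_cast (show 0 < 2 * k by omega)
  have hL : (0 : ℝ) < ((2 * k : ℕ) : ℝ) ^ d := pow_pos h2k d
  set Q : TorusSite d (2 * k) := neelIndex (2 * k) with hQ
  set ε := heisBondCorr (d := d) 0 (2 * k) n with hε
  set s := -ε / 2 with hs_def
  -- `s ≥ 0` from the Néel bound
  have hN := heisBondCorr_le hd n k hk
  have hs : 0 ≤ s := by
    rw [hs_def]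
    have : 0 ≤ ((n : ℝ) / 2) ^ 2 / 3 := by positivity
    linarith
  rw [heisStagShortRangeSum_eq_sum_kernel (2 * k) hd n N, klsShortRangeRiemannSum_of_neZero,
    ← hQ, ← add_sum_erase _ _ (mem_univ Q)]
  rw [hQ, klsShortRangeKernel_neelIndex k hd N, one_mul, ← hQ]
  -- termwise bound on the punctured sum
  have hterm : ∀ q ∈ (univ : Finset (TorusSite d (2 * k))).erase Q,
      klsShortRangeKernel N (2 * k) q * heisStructureFactor 0 (2 * k) n q ≤
        Real.sqrt s * (max (klsShortRangeKernel N (2 * k) q) 0 *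
          Real.sqrt (dispersion (latticeMomentum (2 * k) q) /
            dispersion (latticeMomentum (2 * k) (q - Q)))) := by
    intro q hq
    have hqQ : q ≠ Q := (mem_erase.1 hq).1
    obtain ⟨hg, hAq⟩ := heis_infraredBound hd0 n k hk q hqQ
    have hE' : 0 < dispersion (latticeMomentum (2 * k) (q - Q)) :=
      dispersion_latticeMomentum_pos (sub_ne_zero.2 hqQ)
    rw [← hε] at hAq
    exact kls_heis_pointwise11 hg hE' hs hAq
  have hsum := sum_le_sum hterm
  rw [← mul_sum] at hsum
  rw [add_div, ← mul_div_assoc]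
  gcongr

/-! ### The energy input: `-ε/2 ≤ e/(6d)` from a lower bound on the energy per site -/

/-- `ε = E₀ / (3 d L^d)` on the even torus of side `L = 2k ≥ 4`: the ground energy is `3 Σ_E G⁰`
(isotropy) and the `d L^d` edges are the pairs `(x, x + eᵢ)`. [Kennedy–Lieb–Shastry 1988, eq. (3)
(`⟨S³_0S³_{δᵢ}⟩ = -e₀/3d`)] [cite: KLS1988JSP, eq. (3)] -/
theorem heisBondCorr_eq_groundEnergy_div (hd : 1 ≤ d) (n k : ℕ) (hk : 2 ≤ k) [NeZero (2 * k)] :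
    heisBondCorr (d := d) 0 (2 * k) n =
      (heisenbergTorus d (2 * k) n 1).groundEnergy / (3 * (d : ℝ) * ((2 * k : ℕ) : ℝ) ^ d) := by
  have hL2 : 2 ≤ 2 * k := by omega
  have hd0 : (d : ℝ) ≠ 0 := by exact_mod_cast (show d ≠ 0 by omega)
  have hLd : ((2 * k : ℕ) : ℝ) ^ d ≠ 0 := by
    have : ((2 * k : ℕ) : ℝ) ≠ 0 := by exact_mod_cast (show 2 * k ≠ 0 by omega)
    positivity
  set g : Sym2 (TorusSite d (2 * k)) → ℝ :=
    Sym2.lift ⟨fun x y => heisGroundCorr 0 (2 * k) n x y,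
      fun x y => heisGroundCorr_symm 0 (2 * k) n x y⟩ with hg
  have h1 : (heisenbergTorus d (2 * k) n 1).groundEnergy =
      3 * ∑ e ∈ (torusGraph d (2 * k)).edgeFinset, g e := groundEnergy_heisenbergTorus_eq (2 * k) n
  have h5 := sum_pairs_eq_sum_edgeFinset (2 * k) hL2 g
  rw [if_neg (show ¬ (2 * k = 2) by omega), one_mul] at h5
  have hg' : ∀ (x : TorusSite d (2 * k)) (i : Fin d),
      heisGroundCorr 0 (2 * k) n x (x + Pi.single i 1) = g s(x, x + Pi.single i 1) :=
    fun x i => rfl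
  rw [heisBondCorr_of_neZero]
  simp_rw [hg']
  rw [h5, h1]
  field_simp

/-- **The energy input of (11).** If the ground-state energy per site of the antiferromagnet on the
even torus of side `2k ≥ 4` is at least `-e`, then `-ε/2 ≤ e/(6d)`; hence KLS's `f_q`, and the
bound (11), may be evaluated with any certified LOWER bound `-e` on the energy per site in place
of `-e₀` (`f_q = (e₀ E_q/6dE_{q-Q})^{1/2}` is increasing in `e₀`).
[Kennedy–Lieb–Shastry 1988, eq. (1) and p. 1022] [cite: KLS1988JSP, eq. (1)] -/
theorem neg_heisBondCorr_div_two_le (hd : 1 ≤ d) (n k : ℕ) (hk : 2 ≤ k) [NeZero (2 * k)] {e : ℝ}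
    (hE : -e ≤ (heisenbergTorus d (2 * k) n 1).groundEnergy / ((2 * k : ℕ) : ℝ) ^ d) :
    -heisBondCorr (d := d) 0 (2 * k) n / 2 ≤ e / (6 * d) := by
  have hd0 : (0 : ℝ) < d := by exact_mod_cast (show 0 < d by omega)
  have hLd : (0 : ℝ) < ((2 * k : ℕ) : ℝ) ^ d := by
    have : (0 : ℝ) < ((2 * k : ℕ) : ℝ) := by exact_mod_cast (show 0 < 2 * k by omega)
    positivity
  rw [heisBondCorr_eq_groundEnergy_div hd n k hk]
  rw [le_div_iff₀ hLd] at hE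
  rw [div_le_div_iff₀ (by norm_num) (by positivity)]
  have : -((heisenbergTorus d (2 * k) n 1).groundEnergy / (3 * (d : ℝ) * ((2 * k : ℕ) : ℝ) ^ d)) *
      (6 * d) = -(heisenbergTorus d (2 * k) n 1).groundEnergy * 2 / ((2 * k : ℕ) : ℝ) ^ d := by
    field_simp
    ring
  rw [this, div_le_iff₀ hLd]
  linarith

/-! ### The criterion: Néel order from short-range correlations -/

/-- **Néel order from lower bounds on short-range staggered correlations** (Kennedy–Lieb–Shastry's
Table I criterion, finite-volume form). Spin `n/2`, dimension `d ≥ 1`. Suppose that along the even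
tori of side `L = 2k + 2`, eventually: `ḡ_L(N) ≥ c` (a lower bound on the short-range staggered
sum (10)), `𝓡_L(N) ≤ ρ` (an upper bound on the punctured Riemann sums of `{K_N}₊(E_q/E_{q-Q})^{1/2}`),
and `E₀(H_L)/L^d ≥ -e` (a lower bound on the ground-state energy per site). If
`(e/6d)^{1/2} ρ < c`, then by (11) the Néel order parameter satisfies
`3|Λ|⁻¹ĝ_Q ≥ 3(c - (e/6d)^{1/2} ρ) > 0` eventually, so the ground states of `J Σ 𝐒_x·𝐒_y` have
Néel long-range order along the even tori for every `J > 0`. For `d = 2`, `S = ½` (`n = 1`) this is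
exactly KLS's remark "A contradiction for any one value of n implies that there must be Néel order"
(Table I) with the numerical integral replaced by a certified bound `ρ` on its Riemann sums.
[Kennedy–Lieb–Shastry 1988, eqs. (10)–(11), Table I and p. 1030 ("Rigorous lower bounds on the
short-range correlations could prove the existence of Néel order")]
[cite: KLS1988JSP, eqs. (10)–(11), Table I] -/
theorem heis_neelOrder_of_shortRangeCorr (hd : 1 ≤ d) (n N : ℕ) {c ρ e : ℝ}
    (hcorr : ∀ᶠ k : ℕ in atTop, c ≤ heisStagShortRangeSum (d := d) N (2 * k + 2) n)
    (hR : ∀ᶠ k : ℕ in atTop, klsShortRangeRiemannSum (d := d) N (2 * k + 2) ≤ ρ)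
    (hE : ∀ᶠ k : ℕ in atTop,
      -e ≤ (heisenbergTorus d (2 * k + 2) n 1).groundEnergy / ((2 * k + 2 : ℕ) : ℝ) ^ d)
    (hgap : Real.sqrt (e / (6 * d)) * ρ < c) {J : ℝ} (hJ : 0 < J) :
    HasStaggeredEvenTorusLRO (fun L x y => groundStateSpinCorrTorus (d := d) L n J x y) := by
  rw [hasStaggeredEvenTorusLRO_iff_holds]
  set u : ℝ := Real.sqrt (e / (6 * d)) with hu_def
  have hu0 : 0 ≤ u := Real.sqrt_nonneg _
  set c₀ : ℝ := 3 * (c - u * ρ) with hc₀_def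
  have hc₀ : 0 < c₀ := by
    have : 0 < c - u * ρ := by linarith
    positivity
  have hev : ∀ᶠ k : ℕ in atTop, c₀ ≤
      (∑ x : TorusSite d (2 * k + 2), ∑ y : TorusSite d (2 * k + 2),
          (-1 : ℝ) ^ (∑ i, (x i).val) * (-1) ^ (∑ i, (y i).val) *
            groundStateSpinCorrTorus (2 * k + 2) n J x y) / ((2 * k + 2 : ℕ) : ℝ) ^ (2 * d) := by
    filter_upwards [hcorr, hR, hE, eventually_ge_atTop 1] with k hc hr he hk1
    -- work on the torus of side `2K`, `K = k + 1 ≥ 2`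
    haveI : NeZero (2 * (k + 1)) := ⟨by omega⟩
    have hK : 2 ≤ k + 1 := by omega
    have hsum := neelSum_eq (d := d) n (k + 1) hJ
    have h11 := kls_heis_ineq11 hd n N (k + 1) hK
    have hs : -heisBondCorr (d := d) 0 (2 * (k + 1)) n / 2 ≤ e / (6 * d) :=
      neg_heisBondCorr_div_two_le hd n (k + 1) hK he
    have hR0 : 0 ≤ klsShortRangeRiemannSum (d := d) N (2 * (k + 1)) :=
      klsShortRangeRiemannSum_nonneg N _
    set m : ℝ := heisStructureFactor 0 (2 * (k + 1)) n
      (neelIndex (2 * (k + 1)) : TorusSite d (2 * (k + 1))) / ((2 * (k + 1) : ℕ) : ℝ) ^ d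
      with hm_def
    have hsqrt : Real.sqrt (-heisBondCorr (d := d) 0 (2 * (k + 1)) n / 2) ≤ u :=
      Real.sqrt_le_sqrt hs
    have hprod : Real.sqrt (-heisBondCorr (d := d) 0 (2 * (k + 1)) n / 2) *
        klsShortRangeRiemannSum (d := d) N (2 * (k + 1)) ≤ u * ρ :=
      mul_le_mul hsqrt hr hR0 hu0
    have hcm : c ≤ m + u * ρ := by
      have : heisStagShortRangeSum (d := d) N (2 * (k + 1)) n ≤ m + u * ρ := by
        have := h11
        linarith
      exact le_trans hc this
    show c₀ ≤ (∑ x : TorusSite d (2 * (k + 1)), ∑ y : TorusSite d (2 * (k + 1)),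
          (-1 : ℝ) ^ (∑ i, (x i).val) * (-1) ^ (∑ i, (y i).val) *
            groundStateSpinCorrTorus (2 * (k + 1)) n J x y) / ((2 * (k + 1) : ℕ) : ℝ) ^ (2 * d)
    rw [hsum, hc₀_def]
    linarith
  refine hc₀.trans_le (le_liminf_of_le ?_ hev)
  exact isCoboundedUnder_ge_of_le atTop fun k => by
    haveI : NeZero (2 * k + 2) := ⟨by omega⟩
    exact neelSum_le (d := d) n (2 * k + 2) hJ

/-- **The `d = 2`, `S = ½` instance** (the open case of `kennedy_lieb_shastry_ground`, KLS's
Table I): eventual certified bounds `ḡ_L(N) ≥ c` on the short-range staggered sums of the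
square-lattice spin-½ antiferromagnet along the even tori, `𝓡_L(N) ≤ ρ`, and `E₀(H_L)/L² ≥ -e`,
with `(e/12)^{1/2} ρ < c`, imply Néel long-range order of its ground states (for every `J > 0`).
KLS evaluate `(e₀/12)^{1/2} ∫{K_N}₊(E_q/E_{q-Q})^{1/2}` numerically as `0.228, 0.170, 0.137, 0.115,
0.099, 0.088, 0.079, 0.072` for `N = 1, …, 8` (Table I, with `e₀ ≈ 0.67`); no such bound is asserted
here. [Kennedy–Lieb–Shastry 1988, Table I and p. 1030] [cite: KLS1988JSP, Table I] -/
theorem neelOrder_spinHalf_square_of_shortRangeCorr (N : ℕ) {c ρ e : ℝ}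
    (hcorr : ∀ᶠ k : ℕ in atTop, c ≤ heisStagShortRangeSum (d := 2) N (2 * k + 2) 1)
    (hR : ∀ᶠ k : ℕ in atTop, klsShortRangeRiemannSum (d := 2) N (2 * k + 2) ≤ ρ)
    (hE : ∀ᶠ k : ℕ in atTop,
      -e ≤ (heisenbergTorus 2 (2 * k + 2) 1 1).groundEnergy / ((2 * k + 2 : ℕ) : ℝ) ^ 2)
    (hgap : Real.sqrt (e / 12) * ρ < c) {J : ℝ} (hJ : 0 < J) :
    HasStaggeredEvenTorusLRO (fun L x y => groundStateSpinCorrTorus (d := 2) L 1 J x y) := by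
  refine heis_neelOrder_of_shortRangeCorr (d := 2) (by norm_num) 1 N hcorr hR hE ?_ hJ
  have : (e / (6 * ((2 : ℕ) : ℝ))) = e / 12 := by norm_num
  rw [this]
  exact hgap

/-! ### The one-point (translation-invariant) form of `ḡ_L(N)` -/

/-- **`ḡ_L(N)` in KLS's one-point form.** By translation invariance of the tracial ground state
(`groundStateSpinCorrTorus_add_right_holds`) the site average in `heisStagShortRangeSum` is
superfluous: `ḡ_L(N) = (3 d (N+1))⁻¹ Σ_i Σ_{m=0}^{N} (-1)^m ⟨𝐒_0 · 𝐒_{m eᵢ}⟩_{GS,L}` — the shape in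
which a certificate for the LOCAL observable `Σ_i Σ_m (-1)^m 𝐒_0·𝐒_{m eᵢ}` feeds
`heis_neelOrder_of_shortRangeCorr`. [Kennedy–Lieb–Shastry 1988, eq. (10)]
[cite: KLS1988JSP, eq. (10)] -/
theorem heisStagShortRangeSum_eq_onePoint (N L : ℕ) [NeZero L] (hd : 1 ≤ d) (n : ℕ) :
    heisStagShortRangeSum (d := d) N L n =
      (∑ i : Fin d, ∑ m ∈ range (N + 1),
          (-1 : ℝ) ^ m * groundStateSpinCorrTorus L n 1 0 (Pi.single i ((m : ℕ) : ZMod L))) /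
        (3 * (d : ℝ) * ((N : ℝ) + 1)) := by
  have hd0 : (d : ℝ) ≠ 0 := by exact_mod_cast (show d ≠ 0 by omega)
  have hN : ((N : ℝ) + 1) ≠ 0 := by positivity
  have hL : (L : ℝ) ^ d ≠ 0 := by
    have : (L : ℝ) ≠ 0 := by exact_mod_cast NeZero.ne L
    positivity
  have hcard : (Fintype.card (TorusSite d L) : ℝ) = (L : ℝ) ^ d := by
    rw [Fintype.card_pi, prod_const, ZMod.card, card_univ, Fintype.card_fin]
    push_cast
    ring
  -- translation invariance: every site contributes the same
  have hx : ∀ x : TorusSite d L, (∑ i : Fin d, ∑ m ∈ range (N + 1),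
      (-1 : ℝ) ^ m * groundStateSpinCorrTorus L n 1 x (x + Pi.single i ((m : ℕ) : ZMod L))) =
      ∑ i : Fin d, ∑ m ∈ range (N + 1),
        (-1 : ℝ) ^ m * groundStateSpinCorrTorus L n 1 0 (Pi.single i ((m : ℕ) : ZMod L)) := by
    intro x
    refine sum_congr rfl fun i _ => sum_congr rfl fun m _ => ?_
    have h := groundStateSpinCorrTorus_add_right_holds (d := d) L n 1 x 0
      (Pi.single i ((m : ℕ) : ZMod L))
    rw [zero_add, add_comm] at h
    rw [h]
  rw [heisStagShortRangeSum_of_neZero]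
  simp_rw [hx]
  rw [sum_const, card_univ, nsmul_eq_mul, hcard]
  field_simp

/-! ### Spin ½: the energy input from Anderson's bound -/

/-- **Spin ½, any `d ≥ 1`: the energy hypothesis discharged by Anderson's bound.** For `S = ½`
the tree's `heisenbergAF_torus_groundEnergy_ge` gives `E₀(H_L)/L^d ≥ -(d+1)/4` on every torus of
side `L ≥ 3`, so in `heis_neelOrder_of_shortRangeCorr` one may take `e = (d+1)/4`: eventual bounds
`ḡ_L(N) ≥ c`, `𝓡_L(N) ≤ ρ` with `((d+1)/(24d))^{1/2} ρ < c` imply Néel order of the spin-½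
antiferromagnet. (KLS use the Anderson bound the same way for the `r`-model, p. 1022: "we carry out
this calculation for several values of `e₀` ranging from the Néel bound … to the Anderson bound".)
[Kennedy–Lieb–Shastry 1988, Table I and p. 1022; Anderson 1951] [cite: KLS1988JSP, Table I] -/
theorem heis_neelOrder_spinHalf_of_shortRangeCorr (hd : 1 ≤ d) (N : ℕ) {c ρ : ℝ}
    (hcorr : ∀ᶠ k : ℕ in atTop, c ≤ heisStagShortRangeSum (d := d) N (2 * k + 2) 1)
    (hR : ∀ᶠ k : ℕ in atTop, klsShortRangeRiemannSum (d := d) N (2 * k + 2) ≤ ρ)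
    (hgap : Real.sqrt (((d : ℝ) + 1) / (24 * d)) * ρ < c) {J : ℝ} (hJ : 0 < J) :
    HasStaggeredEvenTorusLRO (fun L x y => groundStateSpinCorrTorus (d := d) L 1 J x y) := by
  have hE : ∀ᶠ k : ℕ in atTop, -(((d : ℝ) + 1) / 4) ≤
      (heisenbergTorus d (2 * k + 2) 1 1).groundEnergy / ((2 * k + 2 : ℕ) : ℝ) ^ d := by
    filter_upwards [eventually_ge_atTop 1] with k hk
    haveI : NeZero (2 * k + 2) := ⟨by omega⟩
    have hL : (0 : ℝ) < ((2 * k + 2 : ℕ) : ℝ) ^ d := by positivity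
    rw [le_div_iff₀ hL]
    have h := heisenbergAF_torus_groundEnergy_ge (d := d) (2 * k + 2) (by omega)
    simpa [neg_mul] using h
  refine heis_neelOrder_of_shortRangeCorr hd 1 N hcorr hR hE ?_ hJ
  have hd0 : (0 : ℝ) < d := by exact_mod_cast (show 0 < d by omega)
  have : ((d : ℝ) + 1) / 4 / (6 * d) = ((d : ℝ) + 1) / (24 * d) := by
    field_simp
    ring
  rw [this]
  exact hgap

/-- **H₀'s shape with the energy input in-tree**: for the spin-½ square-lattice antiferromagnet,
eventual certified bounds `ḡ_L(N) ≥ c` and `𝓡_L(N) ≤ ρ` along the even tori with `ρ < 4c` imply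
Néel long-range order of the ground states (`((2+1)/(24·2))^{1/2} = 1/4`; Anderson's `e₀ ≤ 3/4`
in KLS's `f_q`). Nothing numerical is asserted. [Kennedy–Lieb–Shastry 1988, Table I and p. 1030]
[cite: KLS1988JSP, Table I] -/
theorem neelOrder_spinHalf_square_of_shortRangeCorr_anderson (N : ℕ) {c ρ : ℝ}
    (hcorr : ∀ᶠ k : ℕ in atTop, c ≤ heisStagShortRangeSum (d := 2) N (2 * k + 2) 1)
    (hR : ∀ᶠ k : ℕ in atTop, klsShortRangeRiemannSum (d := 2) N (2 * k + 2) ≤ ρ)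
    (hgap : ρ < 4 * c) {J : ℝ} (hJ : 0 < J) :
    HasStaggeredEvenTorusLRO (fun L x y => groundStateSpinCorrTorus (d := 2) L 1 J x y) := by
  refine heis_neelOrder_spinHalf_of_shortRangeCorr (d := 2) (by norm_num) N hcorr hR ?_ hJ
  have h16 : (((2 : ℕ) : ℝ) + 1) / (24 * ((2 : ℕ) : ℝ)) = (1 / 4) ^ 2 := by norm_num
  rw [h16, Real.sqrt_sq (by norm_num)]
  linarith

end Literature.MathematicalPhysics.QuantumLattice
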